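import Literature.NumberTheory.DiophantineApproximation.RhinViolaDoubleResidueDecomposition
import Mathlib.Algebra.Polynomial.Eval.Degree
import HarnessLib

/-!
# The outer residue of Rhin–Viola's `I_z^{(2)}` as a Hasse derivative of ONE polynomial (polynomial model)

Topic `Literature/NumberTheory/DiophantineApproximation`. Everything here is PROVED (no definitions, no named
facts). Source: G. Rhin, C. Viola, *The permutation group method for the dilogarithm*, Ann. Sc. Norm. Super.
Pisa (5) 4 (2005) 389–437, (2.3) and (2.10): the outer contour integral `(1/2πi)∮_{|x−z|=σ}` of
`x^j(1−x)^h · (inner residue)(x)`, the integrand being a rational function of `x` with its only pole at `x = z`.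

**Polynomial model of the residue at `z`.** If `f(x) = G(x)/(x−z)^N` with `G` a polynomial, then
`Res_{x=z} f = (D^{(N−1)} G)(z)` (Taylor expansion at `z`), and this is insensitive to the representation:
`(D^{(r+e)}(G·(X−z)^e))(z) = (D^{(r)} G)(z)` (`hasseDeriv_mul_X_sub_C_pow_eval`). We show that the outer
integrand of `I_z^{(2)}(h,j,k,l,m)` (`m ≤ j+k`, `n = j+k−m+1`) IS of this form,
`x^j(1−x)^h · innerRes z j k l m x = G(x)/(x−z)^{n+k+l}` for `x ≠ z` with the explicit polynomial
`G = Σ_{i≤k+l} ((−1)^n q_i) • (X^j(1−X)^h (X−z)^{k+l−i})`, `q_i = coeff_i (P∘(1+zW))`, `P = D^{(n−1)}(Y^k(1−Y)^l)`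
(`outerIntegrand_eq_div`), and that the tree's `RhinViola.I2` (defined in `RhinViolaDoubleResidue.lean` by the
expanded Hasse formula) equals `z^{−l−m} · (D^{(n+k+l−1)} G)(z)` (`I2_eq_hasseDeriv_eval`). This is the form in
which identities between outer integrands (e.g. Rhin–Viola's (2.41), (2.6)) transfer to `I2` by linearity.

## References

* G. Rhin, C. Viola, Ann. Sc. Norm. Super. Pisa Cl. Sci. (5) 4 (2005) 389–437, (2.3), (2.10). [RhinViola2005]
-/

noncomputable section

namespace Literature.NumberTheory.DiophantineApproximation

namespace RhinViola

open Finset Polynomial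

/-- **Shift invariance of the polynomial residue**: `(D^{(r+e)}(G·(X−z)^e))(z) = (D^{(r)} G)(z)`
(both are the coefficient of `(x−z)^{−1}` in `G(x)/(x−z)^{r+1}`). [folklore] -/
theorem hasseDeriv_mul_X_sub_C_pow_eval (z : ℝ) (G : ℝ[X]) (r e : ℕ) :
    (hasseDeriv (r + e) (G * (X - C z) ^ e)).eval z = (hasseDeriv r G).eval z := by
  rw [← taylor_coeff, ← taylor_coeff, taylor_mul, taylor_pow, map_sub, taylor_X, taylor_C,
    add_sub_cancel_right, coeff_mul_X_pow]

/-- **The outer integrand is `G(x)/(x−z)^{n+k+l}`** (`m ≤ j+k`, `n = j+k−m+1`, `x ≠ z`), with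
`G = Σ_{i≤k+l} ((−1)^n q_i) • (X^j(1−X)^h (X−z)^{k+l−i})`, `q_i = coeff_i(D^{(n−1)}(Y^k(1−Y)^l) ∘ (1+zW))`:
indeed `P(x/(x−z)) = Q(1/(x−z)) = Σ q_i (x−z)^{−i}` and `(z−x)^{−n} = (−1)^n (x−z)^{−n}`.
[cite: RhinViola2005, (2.3) and (2.10)] -/
theorem outerIntegrand_eq_div {x z : ℝ} (hxz : x ≠ z) {j k l m : ℕ} (hm : m ≤ j + k) (h : ℕ) :
    x ^ j * (1 - x) ^ h * innerRes z j k l m x =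
      (∑ i ∈ range (k + l + 1),
          ((-1) ^ (j + k - m + 1) *
              ((hasseDeriv (j + k - m) ((X : ℝ[X]) ^ k * (1 - X) ^ l)).comp (1 + C z * X)).coeff i) •
            ((X : ℝ[X]) ^ j * (1 - X) ^ h * (X - C z) ^ (k + l - i))).eval x /
        (x - z) ^ (j + k - m + 1 + (k + l)) := by
  have hxz' : x - z ≠ 0 := sub_ne_zero.2 hxz
  set n1 := j + k - m with hn1
  set Q : ℝ[X] := (hasseDeriv n1 ((X : ℝ[X]) ^ k * (1 - X) ^ l)).comp (1 + C z * X) with hQ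
  rw [innerRes, if_pos hm]
  -- `P(x/(x−z)) = Q((x−z)⁻¹) = Σ q_i (x−z)^{-i}`
  have hPQ : (hasseDeriv n1 ((X : ℝ[X]) ^ k * (1 - X) ^ l)).eval (x / (x - z)) = Q.eval (x - z)⁻¹ := by
    rw [hQ, eval_comp]
    congr 1
    simp only [eval_add, eval_one, eval_mul, eval_C, eval_X]
    field_simp
    ring
  have hQsum : Q.eval (x - z)⁻¹ = ∑ i ∈ range (k + l + 1), Q.coeff i * (x - z)⁻¹ ^ i :=
    eval_eq_sum_range' (Nat.lt_succ_of_le (natDegree_hasseDeriv_comp_le z n1 k l)) _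
  rw [hPQ, hQsum, eval_finsetSum]
  simp only [eval_smul, eval_mul, eval_pow, eval_sub, eval_X, eval_C, eval_one, smul_eq_mul]
  -- `(z−x)^{n} = (−1)^{n}(x−z)^{n}` and termwise `(x−z)^{k+l}·(x−z)^{−i} = (x−z)^{k+l−i}`
  have hzx : (z - x) ^ (n1 + 1) = (-1) ^ (n1 + 1) * (x - z) ^ (n1 + 1) := by
    rw [← neg_sub x z, neg_pow]
  have hs : ((-1 : ℝ) ^ (n1 + 1)) * (-1) ^ (n1 + 1) = 1 := by
    rw [← mul_pow]; simp
  rw [hzx, pow_add (x - z) (n1 + 1) (k + l), eq_div_iff (by positivity)]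
  have hS : (x - z) ^ (k + l) * ∑ i ∈ range (k + l + 1), Q.coeff i * (x - z)⁻¹ ^ i =
      ∑ i ∈ range (k + l + 1), Q.coeff i * (x - z) ^ (k + l - i) := by
    rw [Finset.mul_sum]
    refine sum_congr rfl fun i hi => ?_
    have hik : i ≤ k + l := Nat.lt_succ_iff.1 (mem_range.1 hi)
    have hpow : (x - z) ^ (k + l) = (x - z) ^ (k + l - i) * (x - z) ^ i := by
      rw [← pow_add, Nat.sub_add_cancel hik]
    rw [inv_pow, hpow]
    field_simp
  have hinv : (x - z) ^ (n1 + 1) / ((-1) ^ (n1 + 1) * (x - z) ^ (n1 + 1)) = (-1) ^ (n1 + 1) := by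
    rw [div_eq_iff (mul_ne_zero (pow_ne_zero _ (by norm_num)) (pow_ne_zero _ hxz'))]
    linear_combination ((x - z) ^ (n1 + 1)) * hs.symm
  calc x ^ j * (1 - x) ^ h * ((∑ i ∈ range (k + l + 1), Q.coeff i * (x - z)⁻¹ ^ i) /
          ((-1) ^ (n1 + 1) * (x - z) ^ (n1 + 1))) * ((x - z) ^ (n1 + 1) * (x - z) ^ (k + l))
      = x ^ j * (1 - x) ^ h * ((x - z) ^ (k + l) * ∑ i ∈ range (k + l + 1), Q.coeff i * (x - z)⁻¹ ^ i) *
          ((x - z) ^ (n1 + 1) / ((-1) ^ (n1 + 1) * (x - z) ^ (n1 + 1))) := by ring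
    _ = x ^ j * (1 - x) ^ h * (∑ i ∈ range (k + l + 1), Q.coeff i * (x - z) ^ (k + l - i)) *
          (-1) ^ (n1 + 1) := by rw [hS, hinv]
    _ = _ := by
        rw [Finset.mul_sum, Finset.sum_mul]
        exact sum_congr rfl fun i _ => by ring

/-- **`I2` in the polynomial model**: for `m ≤ j+k` (`n = j+k−m+1`),
`I2 z h j k l m = z^{−l−m} · (D^{(n−1+k+l)} G)(z)` with `G` the polynomial of `outerIntegrand_eq_div` — i.e.
`I2` is `z^{−l−m}` times the residue at `x = z` of the outer integrand. [cite: RhinViola2005, (2.3)] -/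
theorem I2_eq_hasseDeriv_eval (z : ℝ) {j k l m : ℕ} (hm : m ≤ j + k) (h : ℕ) :
    I2 z h j k l m = z ^ (-((l : ℤ) + m)) *
      (hasseDeriv (j + k - m + (k + l)) (∑ i ∈ range (k + l + 1),
          ((-1) ^ (j + k - m + 1) *
              ((hasseDeriv (j + k - m) ((X : ℝ[X]) ^ k * (1 - X) ^ l)).comp (1 + C z * X)).coeff i) •
            ((X : ℝ[X]) ^ j * (1 - X) ^ h * (X - C z) ^ (k + l - i)))).eval z := by
  rw [I2, if_pos hm, map_sum, eval_finsetSum, mul_sum]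
  congr 1
  refine sum_congr rfl fun i hi => ?_
  have hik : i ≤ k + l := Nat.lt_succ_iff.1 (mem_range.1 hi)
  rw [LinearMap.map_smul, eval_smul, smul_eq_mul,
    show j + k - m + (k + l) = (i + (j + k - m)) + (k + l - i) by omega,
    hasseDeriv_mul_X_sub_C_pow_eval]
  ring

end RhinViola

end Literature.NumberTheory.DiophantineApproximation

end
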